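import Summits.QuantumFields.YangMills.Theses.RevelationMartingale

/-!
# Route RevelationMartingale — `Assembly` (stmt-QuantumFields-23086)

The route's items compose to the leaf `YM3TorusSU2`: parent `UnitScaleTilt.closes` with its two residual cruxes, the landed
K.2 reduction `unitScaleTilt_historyTailL_of_firstExitWindowTailL`, and the route's glue `WindowTailOfMartingale` fed with the
engine and the two cruxes.  Pure composition; no summit, rung or crux is proved here (all remain hypotheses). [folklore]
-/

namespace Summit.QuantumFields.YangMills.Theorems

open Summit.QuantumFields.YangMills.Theses.RevelationMartingale in
/-- `Assembly` (stmt-QuantumFields-23086) holds: the items compose. [folklore] -/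
theorem revelationMartingale_assembly_proof :
    Summit.QuantumFields.YangMills.Theses.RevelationMartingale.Assembly :=
  fun h200 h201 hS hM hPH hG =>
    Summit.QuantumFields.YangMills.Theses.UnitScaleTilt.closes h200 h201
      (Summit.QuantumFields.YangMills.Theorems.unitScaleTilt_historyTailL_of_firstExitWindowTailL (hG hPH hS hM))

end Summit.QuantumFields.YangMills.Theorems
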